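import Summits.ABC.IUTFork.Conditional.AbcOfSGenuineK
import Summits.ABC.IUTFork.Conditional.AbcOfSGenuineKLicence
import Summits.ABC.IUTFork.Conditional.AbcOfSlackRegimeSzpiro
import HarnessLib

/-!
# Branch C v5 / v5-L (genuine setting OVER `K`): the q-pin DISCHARGED by construction into v5, and the Licence apex with the CONE binder
# cut to the Szpiro-slack residue — `GenuineK.cor312Of_of_hull`, `abc_of_licence_v5K_szpiroSlack`

PROOF-ONLY sequel (0 definitions, 0 `Prop` facts) of abc-iut-C-cert-3's v5 `Conditional/AbcOfSGenuineK.lean` (p434856, hull-level line over the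
CONSTRUCTED pilot datum `Cor312Prov.pilotDataOfK D L`) and v5-L `Conditional/AbcOfSGenuineKLicence.lean` (`GenuineK.cor312Of_of_licence`,
`abc_of_licence_v5K`: the q-pin-free LICENCE form over `K` — the K-level twin of this seat's F-level `Conditional/AbcOfSGenuineLicence.lean`, p432576).
Writer abc-iut-s2-p10 (R2 S-chain team; target «hQPin» + TARGET #1 apex re-composition). TAKES NO SIDE on [IUTchIII] Cor. 3.12; statements about
OUR typed objects; typed ≠ proved; instantiated ≠ endorsed.

1. `GenuineK.cor312Of_of_hull` — RE-COMPOSITION INTO v5's per-datum `GenuineK.cor312Of_of_SH` BY NAME with the q-pin `hQPin` SUPPLIED BY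
   CONSTRUCTION (this seat's `qPinned_settingPrVolSharp`, generic in the base field, at `ρ := fun _ => P.qRegion`, `qK := ∅`): what remains of
   the pair (`hSH`, `hQPin`) is the all-labels hull inclusion `∀ j vQ, P.qRegion j vQ ⊆ P.thetaHull j vQ` (abc-iut-C-cert-1
   `Antecedent.exists_qPinned_and_hull_iff`) — the s2-SCOREBOARD rule-(i) discharge of `hQPin` on the v5 line (its `𝔽_l^⋇` restriction is v5-L's Licence).
2. `abc_of_licence_v5K_szpiroSlack` — v5-L's apex `abc_of_licence_v5K` (data = the context binders of abc-iut-c312-7's print-normalised real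
   setting over `pilotDataOfK T.D T.K`, ideles; hypotheses [SIDE] `htq0 htq1 ht0 ht1 htq` · [LIC] `hLic` · [READ] `hΘ`) with its CONE binder
   `hreg` (the estimate at all non-slot-constant data) CUT to `hresSz` of `Conditional/AbcOfSlackRegimeSzpiro.lean` (p436259): the hull estimate
   with `B_III(P, l)` ONLY at non-slot-constant data of points with `2 ≤ d_mod` above abc-iut-c312-d1's height threshold whose (Ind1) slot
   residue exceeds abc-iut-s2-p1's Szpiro slack. `hreg → hresSz` (`slackRegime_of_hullRegime`, `szpiroSlackRegime_of_slackRegime`), so this is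
   the STRONGER certificate: in the kernel, «`ABC` follows from the (xi-f) licence at the assembled real setting of every genuine Θ-datum over `K`,
   the one-sided Θ-volume identification there, and the hull estimate exactly on the residue locus where no landed estimate applies» — per datum
   LIC 1 · PIN 0 · READ 1 · SIDE 5, CONE 1 (`hresSz`). Tail: `Conditional.ABC_of_cor312_of_szpiroSlackRegime` (abc-iut-S3's Above capstone over
   abc-iut-c312-8's) fed by v5-L's `GenuineK.cor312Of_of_licence` BY NAME.
HONEST FRAMING: this campaign LOCATES / CONDITIONALLY VERIFIES. Nothing here asserts that abc is proved or refuted, that [IUTchIII] Cor. 3.12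
holds or fails at any datum, or takes a side on any author; the licence is an assumption label (E3 of record, C-lead C-R18: refuted at deep /
odd-unramified bad packets in realising shape, undecided in case B-shallow). [claim: Mochizuki2012, status: disputed]
[cite: Mochizuki2012, IUTchI Ex. 3.2 (iv) p. 71; IUTchIII Cor. 3.12 Step (xi-f) p. 184] [cite: DupuyHilado2025, §3.3, §3.4, §3.9]
-/

noncomputable section

open Set Function NumberField IsDedekindDomain

namespace Summit.ABC.IUTFork.Conditional

open Thm311 Thm311.Real Cor312 Cor312Vol Cor312Prov Literature.IUT.LogThetaLattice Literature.IUT.LogVolume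
  Literature.IUT.HodgeTheaters Literature.IUT.LogVolume.ThetaData

/-! ## 1. One datum over `L ⊇ F`: v5's lemma with the q-pin supplied by construction -/

section PerDatum

variable {F K Fbar : Type} [Field F] [NumberField F] [Field K] [NumberField K] [Algebra F K] [Field Fbar]
  [Algebra F Fbar] [Algebra K Fbar] {E : WeierstrassCurve F} [E.IsElliptic] {l : ℕ} {Pb : BadPlacePredicates K}
  (D : InitialThetaData F K Fbar E l Pb) {I : ThetaVolumeInput (fieldOfModuli E) K}
  (L : Type) [Field L] [NumberField L] [Algebra F L] (M : Type) [Field M] [NumberField M]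
  (archPk : ∀ (j : (thetaIndex (pilotDataOfK D L)).Label) (vQ : (thetaIndex (pilotDataOfK D L)).VQ), Set ((logShellsDH (pilotDataOfK D L) (analyticLogv L)).Packet j vQ))
  (archSub : ∀ (j : (thetaIndex (pilotDataOfK D L)).Label) (v : (thetaIndex (pilotDataOfK D L)).V),
    Set ((logShellsDH (pilotDataOfK D L) (analyticLogv L)).Packet j ((thetaIndex (pilotDataOfK D L)).over v)))
  (Ψ : ℤ → ∀ v : (thetaIndex (pilotDataOfK D L)).V, v ∈ (thetaIndex (pilotDataOfK D L)).Vbad → Set ((logShellsDH (pilotDataOfK D L) (analyticLogv L)).StarPacket v))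
  (act : ℤ → ∀ v : (thetaIndex (pilotDataOfK D L)).V, v ∈ (thetaIndex (pilotDataOfK D L)).Vbad →
    (logShellsDH (pilotDataOfK D L) (analyticLogv L)).StarPacket v → Module.End ℚ ((logShellsDH (pilotDataOfK D L) (analyticLogv L)).StarPacket v))
  (Mmod : ℤ → ∀ j : (thetaIndex (pilotDataOfK D L)).LabelStar, Set ((logShellsDH (pilotDataOfK D L) (analyticLogv L)).GlobalPacket j.1))
  (region : ℤ → ∀ j : (thetaIndex (pilotDataOfK D L)).LabelStar, FinDivisor M → ∀ vQ : (thetaIndex (pilotDataOfK D L)).VQ,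
    Set ((logShellsDH (pilotDataOfK D L) (analyticLogv L)).Packet j.1 vQ))
  (n : ℤ) {HT : Type} {LogLink : HT → HT → Type} {IsFull : ∀ {s t : HT}, LogLink s t → Prop}
  (lat : LGPGaussianLogThetaLattice LogLink IsFull)
  {Frd : Type} {IsoF : Frd → Frd → Type} {Ob : Frd → Type} {realify : Frd → Frd} {Strip : Type}
  {IsoS : Strip → Strip → Type} {Mv : ∀ v : (thetaIndex (pilotDataOfK D L)).V, v ∈ (thetaIndex (pilotDataOfK D L)).Vbad → Type}
  [∀ v h, Monoid (Mv v h)]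
  (sig : GlobalLGPFrobenioidSignature (thetaIndex (pilotDataOfK D L)).lstar (thetaIndex (pilotDataOfK D L)).V (· ∈ (thetaIndex (pilotDataOfK D L)).Vbad)
    Frd IsoF Ob realify Strip IsoS Mv)
  (split : SplittingMonoids Mv) {ObΔ : Type} {N : ∀ v : (thetaIndex (pilotDataOfK D L)).V, v ∈ (thetaIndex (pilotDataOfK D L)).Vbad → Type}
  [∀ v h, Monoid (N v h)] (qData : QPilotData ObΔ N)
  (t : ∀ (pp : Nat.Primes) (_ : Fin (pilotDataOfK D L).lstar) (x : (thetaIndex (pilotDataOfK D L)).Fibre (.inr pp)),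
    haveI : Fact (pp : ℕ).Prime := ⟨pp.2⟩; kOf (pilotDataOfK D L) pp.1 x)
  (tq : ∀ (pp : Nat.Primes) (x : (thetaIndex (pilotDataOfK D L)).Fibre (.inr pp)), haveI : Fact (pp : ℕ).Prime := ⟨pp.2⟩; kOf (pilotDataOfK D L) pp.1 x)

-- v5's column binders, kept VERBATIM so that v5's lemma is instantiated as landed (they constrain nothing here)
variable
  (frobAdm : ℤ → ℤ → ∀ (j : (thetaIndex (pilotDataOfK D L)).Label) (vQ : (thetaIndex (pilotDataOfK D L)).VQ),
    Set ((logShellsDH (pilotDataOfK D L) (analyticLogv L)).Packet j vQ) → Prop)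
  (frobLogvol : ℤ → ℤ → ∀ (j : (thetaIndex (pilotDataOfK D L)).Label) (vQ : (thetaIndex (pilotDataOfK D L)).VQ),
    Set ((logShellsDH (pilotDataOfK D L) (analyticLogv L)).Packet j vQ) → ℝ)
  (frobΨ : ℤ → ℤ → ∀ v : (thetaIndex (pilotDataOfK D L)).V, v ∈ (thetaIndex (pilotDataOfK D L)).Vbad → Set ((logShellsDH (pilotDataOfK D L) (analyticLogv L)).StarPacket v))
  (frobMmod : ℤ → ℤ → ∀ j : (thetaIndex (pilotDataOfK D L)).LabelStar, Set ((logShellsDH (pilotDataOfK D L) (analyticLogv L)).GlobalPacket j.1))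
  (unitImage : ℤ → ℤ → ℕ → ∀ (j : (thetaIndex (pilotDataOfK D L)).Label) (vQ : (thetaIndex (pilotDataOfK D L)).VQ),
    Set ((logShellsDH (pilotDataOfK D L) (analyticLogv L)).Packet j vQ))
  (ballImage : ℤ → ℤ → ∀ (j : (thetaIndex (pilotDataOfK D L)).Label) (vQ : (thetaIndex (pilotDataOfK D L)).VQ),
    Set ((logShellsDH (pilotDataOfK D L) (analyticLogv L)).Packet j vQ))
  (thetaDiv : ℤ → ℤ → LgpDivisor M (thetaIndex (pilotDataOfK D L)).lstar)

include frobAdm frobLogvol frobΨ frobMmod unitImage ballImage thetaDiv in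
/-- **v5's `GenuineK.cor312Of_of_SH` with `hQPin` DISCHARGED by construction** (this seat's `qPinned_settingPrVolSharp` — generic in the base
field — at `ρ := fun _ => P.qRegion`, `qK := ∅`): what is left of the pair (`hSH`, `hQPin`) is the all-labels hull inclusion
`∀ j vQ, P.qRegion j vQ ⊆ P.thetaHull j vQ`. Composed BY NAME into v5's lemma; same remaining binders as v5. [claim: Mochizuki2012, status: disputed] -/
theorem GenuineK.cor312Of_of_hull (hI : ThetaData.IsVolumeInputOf D I)
    (htq0 : ∀ pp x, tq pp x ≠ 0)
    (htq1 : ∀ (pp : Nat.Primes) (x : (thetaIndex (pilotDataOfK D L)).Fibre (.inr pp)),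
      haveI : Fact (pp : ℕ).Prime := ⟨pp.2⟩; placeOf (pilotDataOfK D L) pp.1 x ∉ (pilotDataOfK D L).S → ‖tq pp x‖ = 1)
    (ht0 : ∀ pp i x, t pp i x ≠ 0)
    (ht1 : ∀ (pp : Nat.Primes) (i : Fin (pilotDataOfK D L).lstar) (x : (thetaIndex (pilotDataOfK D L)).Fibre (.inr pp)),
      haveI : Fact (pp : ℕ).Prime := ⟨pp.2⟩; placeOf (pilotDataOfK D L) pp.1 x ∉ (pilotDataOfK D L).S → ‖t pp i x‖ = 1)
    (htq : ∀ (pp : Nat.Primes) (x : (thetaIndex (pilotDataOfK D L)).Fibre (.inr pp)),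
      haveI : Fact (pp : ℕ).Prime := ⟨pp.2⟩
      Real.log ‖tq pp x‖ = -((pilotDataOfK D L).qPilot (placeOf (pilotDataOfK D L) pp.1 x)) * logNorm L (placeOf (pilotDataOfK D L) pp.1 x) /
        localDegree L (placeOf (pilotDataOfK D L) pp.1 x))
    (hH : ∀ (j : (thetaIndex (pilotDataOfK D L)).Label) (vQ : (thetaIndex (pilotDataOfK D L)).VQ),
      (settingPrVolSharp (pilotDataOfK D L) (logvAnalytic_analyticLogv (F := L)) M archPk archSub Ψ act Mmod region n lat sig split
          qData tq t htq0 htq1).qRegion j vQ ⊆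
        (settingPrVolSharp (pilotDataOfK D L) (logvAnalytic_analyticLogv (F := L)) M archPk archSub Ψ act Mmod region n lat sig split
          qData tq t htq0 htq1).thetaHull j vQ)
    (hΘ : (settingPrVolSharp (pilotDataOfK D L) (logvAnalytic_analyticLogv (F := L)) M archPk archSub Ψ act Mmod region n lat sig split
        qData tq t htq0 htq1).negLogTheta ≤
      ((I.negLogTheta : ℝ) : WithTop ℝ)) :
    I.Cor312Of :=
  GenuineK.cor312Of_of_SH D L M archPk archSub Ψ act Mmod region frobAdm frobLogvol frobΨ frobMmod unitImage ballImage thetaDiv n lat sig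
    split qData t tq
    (fun _ => (settingPrVolSharp (pilotDataOfK D L) (logvAnalytic_analyticLogv (F := L)) M archPk archSub Ψ act Mmod region n lat sig
      split qData tq t htq0 htq1).qRegion)
    (fun _ _ => ∅) hI htq0 htq1 ht0 ht1 htq (fun j vQ => hH j vQ)
    (qPinned_settingPrVolSharp (pilotDataOfK D L) M archPk archSub Ψ act Mmod region frobAdm frobLogvol frobΨ frobMmod unitImage
      ballImage thetaDiv n lat sig split qData tq t htq0 htq1 _) hΘ

end PerDatum

/-! ## 2. The apex over `K` of every datum: v5-L's Licence bundle + the Szpiro-slack residue CONE binder ⟹ `ABC` -/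

section Family

open Literature.NumberTheory.DiophantineGeometry.GenEll Summit.ABC.ABC.Theorems

/-- **`abc_of_licence_v5K_szpiroSlack` — v5-L's apex `abc_of_licence_v5K` (abc-iut-C-cert-3) with the CONE binder `hreg` CUT to the
Szpiro-slack residue `hresSz`.** `ABC` from, per `λ`-line point `P`, prime `l` and genuine Θ-volume datum `T`: DATA = the context
binders of abc-iut-c312-7's print-normalised real setting over the constructed pilot datum `pilotDataOfK T.D T.K`, Θ-ideles and q-ideles in the
completions of `K` — NO columns, NO `ρ`, NO `qK`, no pilot-data / provenance / field binder; HYPOTHESES = [SIDE] `htq0 htq1 ht0 ht1`, `htq`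
(satisfiable: v5 `GenuineK.sideConditions_satisfiable_K`) · [LICENCE] `hLic` · [READ] `hΘ` one-sided · [CONE] `hresSz`. Proof: §1 at `T.D`,
`T.I`, `T.isVolumeInputOf`, `L := T.K` gives `Cor22.Cor312AtDatum P l`; then `Conditional.ABC_of_cor312_of_szpiroSlackRegime`. v5's hypotheses imply
these pointwise (`hreg → hresSz`: `slackRegime_of_hullRegime`, `szpiroSlackRegime_of_slackRegime`), so this is the STRONGER certificate. «`ABC` follows from the Licence +
these hypotheses as typed, at these data» — no side taken on [IUTchIII] Cor. 3.12; typed ≠ proved; instantiated ≠ endorsed.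
[claim: Mochizuki2012, status: disputed] -/
theorem abc_of_licence_v5K_szpiroSlack
    -- DATA, per datum: the context binders of the genuine real setting over `pilotDataOfK T.D T.K` (logs FIXED: analytic), ideles — NO columns, ρ, qK
    (M : ∀ (P : NFPoint) (l : ℕ) (T : Cor22.ThetaVolumeDatumAt P l), Type) [∀ P l T, Field (M P l T)] [∀ P l T, NumberField (M P l T)]
    (archPk : ∀ (P : NFPoint) (l : ℕ) (T : Cor22.ThetaVolumeDatumAt P l), letI := T.instFieldF; letI := T.instNumberFieldF; letI := T.instAlgebraF; letI := T.instFieldK;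
        letI := T.instNumberFieldK; letI := T.instAlgebraK; letI := T.instFieldFbar; letI := T.instAlgebraFbar;
        letI := T.instAlgebraKFbar; letI := T.instIsElliptic;
      ∀ (j : (thetaIndex (pilotDataOfK T.D T.K)).Label) (vQ : (thetaIndex (pilotDataOfK T.D T.K)).VQ), Set ((logShellsDH (pilotDataOfK T.D T.K) (analyticLogv T.K)).Packet j vQ))
    (archSub : ∀ (P : NFPoint) (l : ℕ) (T : Cor22.ThetaVolumeDatumAt P l), letI := T.instFieldF; letI := T.instNumberFieldF; letI := T.instAlgebraF; letI := T.instFieldK;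
        letI := T.instNumberFieldK; letI := T.instAlgebraK; letI := T.instFieldFbar; letI := T.instAlgebraFbar;
        letI := T.instAlgebraKFbar; letI := T.instIsElliptic;
      ∀ (j : (thetaIndex (pilotDataOfK T.D T.K)).Label) (v : (thetaIndex (pilotDataOfK T.D T.K)).V), Set ((logShellsDH (pilotDataOfK T.D T.K) (analyticLogv T.K)).Packet j ((thetaIndex (pilotDataOfK T.D T.K)).over v)))
    (Ψ : ∀ (P : NFPoint) (l : ℕ) (T : Cor22.ThetaVolumeDatumAt P l), letI := T.instFieldF; letI := T.instNumberFieldF; letI := T.instAlgebraF; letI := T.instFieldK;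
        letI := T.instNumberFieldK; letI := T.instAlgebraK; letI := T.instFieldFbar; letI := T.instAlgebraFbar;
        letI := T.instAlgebraKFbar; letI := T.instIsElliptic;
      ℤ → ∀ v : (thetaIndex (pilotDataOfK T.D T.K)).V, v ∈ (thetaIndex (pilotDataOfK T.D T.K)).Vbad → Set ((logShellsDH (pilotDataOfK T.D T.K) (analyticLogv T.K)).StarPacket v))
    (act : ∀ (P : NFPoint) (l : ℕ) (T : Cor22.ThetaVolumeDatumAt P l), letI := T.instFieldF; letI := T.instNumberFieldF; letI := T.instAlgebraF; letI := T.instFieldK;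
        letI := T.instNumberFieldK; letI := T.instAlgebraK; letI := T.instFieldFbar; letI := T.instAlgebraFbar;
        letI := T.instAlgebraKFbar; letI := T.instIsElliptic;
      ℤ → ∀ v : (thetaIndex (pilotDataOfK T.D T.K)).V, v ∈ (thetaIndex (pilotDataOfK T.D T.K)).Vbad → (logShellsDH (pilotDataOfK T.D T.K) (analyticLogv T.K)).StarPacket v → Module.End ℚ ((logShellsDH (pilotDataOfK T.D T.K) (analyticLogv T.K)).StarPacket v))
    (Mmod : ∀ (P : NFPoint) (l : ℕ) (T : Cor22.ThetaVolumeDatumAt P l), letI := T.instFieldF; letI := T.instNumberFieldF; letI := T.instAlgebraF; letI := T.instFieldK;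
        letI := T.instNumberFieldK; letI := T.instAlgebraK; letI := T.instFieldFbar; letI := T.instAlgebraFbar;
        letI := T.instAlgebraKFbar; letI := T.instIsElliptic;
      ℤ → ∀ j : (thetaIndex (pilotDataOfK T.D T.K)).LabelStar, Set ((logShellsDH (pilotDataOfK T.D T.K) (analyticLogv T.K)).GlobalPacket j.1))
    (region : ∀ (P : NFPoint) (l : ℕ) (T : Cor22.ThetaVolumeDatumAt P l), letI := T.instFieldF; letI := T.instNumberFieldF; letI := T.instAlgebraF; letI := T.instFieldK;
        letI := T.instNumberFieldK; letI := T.instAlgebraK; letI := T.instFieldFbar; letI := T.instAlgebraFbar;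
        letI := T.instAlgebraKFbar; letI := T.instIsElliptic;
      ℤ → ∀ j : (thetaIndex (pilotDataOfK T.D T.K)).LabelStar, FinDivisor (M P l T) → ∀ vQ : (thetaIndex (pilotDataOfK T.D T.K)).VQ, Set ((logShellsDH (pilotDataOfK T.D T.K) (analyticLogv T.K)).Packet j.1 vQ))
    (n : ∀ (P : NFPoint) (l : ℕ) (T : Cor22.ThetaVolumeDatumAt P l), ℤ)
    {HT : ∀ (P : NFPoint) (l : ℕ) (T : Cor22.ThetaVolumeDatumAt P l), Type} {LogLink : ∀ (P : NFPoint) (l : ℕ) (T : Cor22.ThetaVolumeDatumAt P l), HT P l T → HT P l T → Type}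
    {IsFull : ∀ (P : NFPoint) (l : ℕ) (T : Cor22.ThetaVolumeDatumAt P l), ∀ {s t : HT P l T}, LogLink P l T s t → Prop}
    (lat : ∀ (P : NFPoint) (l : ℕ) (T : Cor22.ThetaVolumeDatumAt P l), LGPGaussianLogThetaLattice (LogLink P l T) (IsFull P l T))
    {Frd : ∀ (P : NFPoint) (l : ℕ) (T : Cor22.ThetaVolumeDatumAt P l), Type} {IsoF : ∀ (P : NFPoint) (l : ℕ) (T : Cor22.ThetaVolumeDatumAt P l), Frd P l T → Frd P l T → Type} {Ob : ∀ (P : NFPoint) (l : ℕ) (T : Cor22.ThetaVolumeDatumAt P l), Frd P l T → Type}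
    {realify : ∀ (P : NFPoint) (l : ℕ) (T : Cor22.ThetaVolumeDatumAt P l), Frd P l T → Frd P l T} {Strip : ∀ (P : NFPoint) (l : ℕ) (T : Cor22.ThetaVolumeDatumAt P l), Type} {IsoS : ∀ (P : NFPoint) (l : ℕ) (T : Cor22.ThetaVolumeDatumAt P l), Strip P l T → Strip P l T → Type}
    {Mv : ∀ (P : NFPoint) (l : ℕ) (T : Cor22.ThetaVolumeDatumAt P l), letI := T.instFieldF; letI := T.instNumberFieldF; letI := T.instAlgebraF; letI := T.instFieldK;
        letI := T.instNumberFieldK; letI := T.instAlgebraK; letI := T.instFieldFbar; letI := T.instAlgebraFbar;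
        letI := T.instAlgebraKFbar; letI := T.instIsElliptic;
      ∀ v : (thetaIndex (pilotDataOfK T.D T.K)).V, v ∈ (thetaIndex (pilotDataOfK T.D T.K)).Vbad → Type}
    [∀ P l T v h, Monoid (Mv P l T v h)]
    (sig : ∀ (P : NFPoint) (l : ℕ) (T : Cor22.ThetaVolumeDatumAt P l), letI := T.instFieldF; letI := T.instNumberFieldF; letI := T.instAlgebraF; letI := T.instFieldK;
        letI := T.instNumberFieldK; letI := T.instAlgebraK; letI := T.instFieldFbar; letI := T.instAlgebraFbar;
        letI := T.instAlgebraKFbar; letI := T.instIsElliptic;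
      GlobalLGPFrobenioidSignature (thetaIndex (pilotDataOfK T.D T.K)).lstar (thetaIndex (pilotDataOfK T.D T.K)).V (· ∈ (thetaIndex (pilotDataOfK T.D T.K)).Vbad) (Frd P l T) (IsoF P l T) (Ob P l T) (realify P l T)
        (Strip P l T) (IsoS P l T) (Mv P l T))
    (split : ∀ (P : NFPoint) (l : ℕ) (T : Cor22.ThetaVolumeDatumAt P l), SplittingMonoids (Mv P l T))
    {ObΔ : ∀ (P : NFPoint) (l : ℕ) (T : Cor22.ThetaVolumeDatumAt P l), Type} {N : ∀ (P : NFPoint) (l : ℕ) (T : Cor22.ThetaVolumeDatumAt P l), letI := T.instFieldF; letI := T.instNumberFieldF; letI := T.instAlgebraF; letI := T.instFieldK;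
        letI := T.instNumberFieldK; letI := T.instAlgebraK; letI := T.instFieldFbar; letI := T.instAlgebraFbar;
        letI := T.instAlgebraKFbar; letI := T.instIsElliptic;
      ∀ v : (thetaIndex (pilotDataOfK T.D T.K)).V, v ∈ (thetaIndex (pilotDataOfK T.D T.K)).Vbad → Type}
    [∀ P l T v h, Monoid (N P l T v h)] (qData : ∀ (P : NFPoint) (l : ℕ) (T : Cor22.ThetaVolumeDatumAt P l), QPilotData (ObΔ P l T) (N P l T))
    (t : ∀ (P : NFPoint) (l : ℕ) (T : Cor22.ThetaVolumeDatumAt P l), letI := T.instFieldF; letI := T.instNumberFieldF; letI := T.instAlgebraF; letI := T.instFieldK;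
        letI := T.instNumberFieldK; letI := T.instAlgebraK; letI := T.instFieldFbar; letI := T.instAlgebraFbar;
        letI := T.instAlgebraKFbar; letI := T.instIsElliptic;
      ∀ (pp : Nat.Primes) (_ : Fin (pilotDataOfK T.D T.K).lstar) (x : (thetaIndex (pilotDataOfK T.D T.K)).Fibre (.inr pp)), haveI : Fact (pp : ℕ).Prime := ⟨pp.2⟩; kOf (pilotDataOfK T.D T.K) pp.1 x)
    (tq : ∀ (P : NFPoint) (l : ℕ) (T : Cor22.ThetaVolumeDatumAt P l), letI := T.instFieldF; letI := T.instNumberFieldF; letI := T.instAlgebraF; letI := T.instFieldK;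
        letI := T.instNumberFieldK; letI := T.instAlgebraK; letI := T.instFieldFbar; letI := T.instAlgebraFbar;
        letI := T.instAlgebraKFbar; letI := T.instIsElliptic;
      ∀ (pp : Nat.Primes) (x : (thetaIndex (pilotDataOfK T.D T.K)).Fibre (.inr pp)), haveI : Fact (pp : ℕ).Prime := ⟨pp.2⟩; kOf (pilotDataOfK T.D T.K) pp.1 x)
    -- [SIDE] ideles non-zero, units off `S`; the q-ideles REALISE `P_q` in the completions of `K` (satisfiable under `TwoMulLDvdOrdq`, §1 witness)
    (htq0 : ∀ P l T pp x, tq P l T pp x ≠ 0)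
    (htq1 : ∀ (P : NFPoint) (l : ℕ) (T : Cor22.ThetaVolumeDatumAt P l), letI := T.instFieldF; letI := T.instNumberFieldF; letI := T.instAlgebraF; letI := T.instFieldK;
        letI := T.instNumberFieldK; letI := T.instAlgebraK; letI := T.instFieldFbar; letI := T.instAlgebraFbar;
        letI := T.instAlgebraKFbar; letI := T.instIsElliptic;
      ∀ (pp : Nat.Primes) (x : (thetaIndex (pilotDataOfK T.D T.K)).Fibre (.inr pp)),
        haveI : Fact (pp : ℕ).Prime := ⟨pp.2⟩; placeOf (pilotDataOfK T.D T.K) pp.1 x ∉ (pilotDataOfK T.D T.K).S → ‖tq P l T pp x‖ = 1)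
    (ht0 : ∀ P l T pp i x, t P l T pp i x ≠ 0)
    (ht1 : ∀ (P : NFPoint) (l : ℕ) (T : Cor22.ThetaVolumeDatumAt P l), letI := T.instFieldF; letI := T.instNumberFieldF; letI := T.instAlgebraF; letI := T.instFieldK;
        letI := T.instNumberFieldK; letI := T.instAlgebraK; letI := T.instFieldFbar; letI := T.instAlgebraFbar;
        letI := T.instAlgebraKFbar; letI := T.instIsElliptic;
      ∀ (pp : Nat.Primes) (i : Fin (pilotDataOfK T.D T.K).lstar) (x : (thetaIndex (pilotDataOfK T.D T.K)).Fibre (.inr pp)),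
        haveI : Fact (pp : ℕ).Prime := ⟨pp.2⟩; placeOf (pilotDataOfK T.D T.K) pp.1 x ∉ (pilotDataOfK T.D T.K).S → ‖t P l T pp i x‖ = 1)
    (htq : ∀ (P : NFPoint) (l : ℕ) (T : Cor22.ThetaVolumeDatumAt P l), letI := T.instFieldF; letI := T.instNumberFieldF; letI := T.instAlgebraF; letI := T.instFieldK;
        letI := T.instNumberFieldK; letI := T.instAlgebraK; letI := T.instFieldFbar; letI := T.instAlgebraFbar;
        letI := T.instAlgebraKFbar; letI := T.instIsElliptic;
      ∀ (pp : Nat.Primes) (x : (thetaIndex (pilotDataOfK T.D T.K)).Fibre (.inr pp)),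
        haveI : Fact (pp : ℕ).Prime := ⟨pp.2⟩
        Real.log ‖tq P l T pp x‖ = -((pilotDataOfK T.D T.K).qPilot (placeOf (pilotDataOfK T.D T.K) pp.1 x)) * logNorm T.K (placeOf (pilotDataOfK T.D T.K) pp.1 x) /
          localDegree T.K (placeOf (pilotDataOfK T.D T.K) pp.1 x))
    -- [LICENCE] abc-iut-c312-1's (xi-f) Licence of the genuine setting over `K`, at every datum, AT THESE DATA (no ρ, no qK, no q-pin)
    (hLic : ∀ (P : NFPoint) (l : ℕ) (T : Cor22.ThetaVolumeDatumAt P l), letI := T.instFieldF; letI := T.instNumberFieldF; letI := T.instAlgebraF; letI := T.instFieldK;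
        letI := T.instNumberFieldK; letI := T.instAlgebraK; letI := T.instFieldFbar; letI := T.instAlgebraFbar;
        letI := T.instAlgebraKFbar; letI := T.instIsElliptic;
      Thm311ToCor312.Licence
        (settingPrVolSharp (pilotDataOfK T.D T.K) (logvAnalytic_analyticLogv (F := T.K)) (M P l T) (archPk P l T) (archSub P l T) (Ψ P l T)
          (act P l T) (Mmod P l T) (region P l T) (n P l T) (lat P l T) (sig P l T) (split P l T) (qData P l T) (tq P l T)
          (t P l T) (htq0 P l T) (htq1 P l T)))
    -- [FACT] (none) · [CONE] the hull-volume estimate with `B_III` ONLY at non-slot-constant data of points with `2 ≤ d_mod` above the height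
    -- threshold whose (Ind1) slot residue exceeds abc-iut-s2-p1's SZPIRO SLACK (`Conditional.hullVolume_of_szpiroSlackRegime`'s `hresSz`)
    (hresSz : ∀ P : NFPoint, P ∈ UP → ∀ l : ℕ, l.Prime → 5 ≤ l →
      Cor22.AdmitsCore P → Cor22.CondP2 P l → Cor22.CondP5 P l → Cor22.CondP6 P l →
      2 ≤ Cor22.dmod P →
      40 * Real.log (((2 ^ 12 * 3 ^ 3 * 5 * Cor22.dmod P : ℕ) : ℝ) * l)
        * ((Nat.primeCounting (2 ^ 12 * 3 ^ 3 * 5 * Cor22.dmod P * l) : ℝ)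
          - (2 * (Cor22.dmod P : ℝ) * (P.logDiff + Cor22.logCondAvoid P {2, l}) + Real.log (2 * 3 * 5 * (l : ℝ)))
            / Real.log 2) < Cor22.logQAvoid P {2, l} →
      ∀ T : Cor22.ThetaVolumeDatumAt P l,
        (letI := T.instFieldF; letI := T.instNumberFieldF; letI := T.instAlgebraF; letI := T.instFieldK
         letI := T.instNumberFieldK; letI := T.instAlgebraK; letI := T.instFieldFbar; letI := T.instAlgebraFbar
         letI := T.instAlgebraKFbar; letI := T.instIsElliptic
         ¬ (∀ p ∈ T.I.supportPrimes, ∀ v w : placesOver (fieldOfModuli T.E) p,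
            (Summit.ABC.IUTFork.DHData.ofInput T.I).logQloc p v = (Summit.ABC.IUTFork.DHData.ofInput T.I).logQloc p w)) →
        (letI := T.instFieldF; letI := T.instNumberFieldF; letI := T.instFieldK; letI := T.instNumberFieldK
         letI := T.instAlgebraK
         ((l : ℝ) + 1) / 4 * (4 * ((Cor22.dmod P : ℝ) - 1) / l * (P.logDiff + Cor22.logCondAvoid P {2, l})
            + 20 / 3 * Real.log (((2 ^ 12 * 3 ^ 3 * 5 * Cor22.dmod P : ℕ) : ℝ) * l)
              * ((Nat.primeCounting (2 ^ 12 * 3 ^ 3 * 5 * Cor22.dmod P * l) : ℝ)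
                - ((T.I.supportPrimes.filter (· ≤ 2 ^ 12 * 3 ^ 3 * 5 * Cor22.dmod P * l)).card : ℝ))) <
           T.I.X.slotResidue T.I.supportPrimes) →
        T.HullEstimateOf
          (((l : ℝ) + 1) / 4 *
            ((1 + 12 * (Cor22.dmod P : ℝ) / l) * (P.logDiff + Cor22.logCondAvoid P {2, l})
              + 2 * Real.log l + 52
              + 20 / 3 * Real.log (((2 ^ 12 * 3 ^ 3 * 5 * Cor22.dmod P : ℕ) : ℝ) * (l : ℝ))
                * (Nat.primeCounting (2 ^ 12 * 3 ^ 3 * 5 * Cor22.dmod P * l) : ℝ))))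
    -- [READ] the ONE-SIDED Θ-side identification (the q-side is DISCHARGED — no `hq`)
    (hΘ : ∀ (P : NFPoint) (l : ℕ) (T : Cor22.ThetaVolumeDatumAt P l), letI := T.instFieldF; letI := T.instNumberFieldF; letI := T.instAlgebraF; letI := T.instFieldK;
        letI := T.instNumberFieldK; letI := T.instAlgebraK; letI := T.instFieldFbar; letI := T.instAlgebraFbar;
        letI := T.instAlgebraKFbar; letI := T.instIsElliptic;
      (settingPrVolSharp (pilotDataOfK T.D T.K) (logvAnalytic_analyticLogv (F := T.K)) (M P l T) (archPk P l T) (archSub P l T) (Ψ P l T)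
          (act P l T) (Mmod P l T) (region P l T) (n P l T) (lat P l T) (sig P l T) (split P l T) (qData P l T) (tq P l T)
          (t P l T) (htq0 P l T) (htq1 P l T)).negLogTheta ≤ ((T.negLogTheta : ℝ) : WithTop ℝ)) :
    _root_.ABC := by
  -- Step 1–2: [IUTchIII] Cor 3.12 at EVERY genuine Θ-volume datum on the LICENCE line OVER `K` (§1 under `T`'s bundled instances)
  have h312 : ∀ (P : NFPoint) (l : ℕ), Cor22.Cor312AtDatum P l := fun P l T => by
    letI := T.instFieldF; letI := T.instNumberFieldF; letI := T.instAlgebraF; letI := T.instFieldK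
    letI := T.instNumberFieldK; letI := T.instAlgebraK; letI := T.instFieldFbar; letI := T.instAlgebraFbar
    letI := T.instAlgebraKFbar; letI := T.instIsElliptic
    exact GenuineK.cor312Of_of_licence T.D T.K (M P l T) (archPk P l T) (archSub P l T) (Ψ P l T) (act P l T) (Mmod P l T)
      (region P l T) (n P l T) (lat P l T) (sig P l T) (split P l T) (qData P l T) (t P l T) (tq P l T)
      T.isVolumeInputOf (htq0 P l T) (htq1 P l T) (ht0 P l T) (ht1 P l T) (htq P l T) (hLic P l T) (hΘ P l T)
  -- Step 3: the (U)-line capstone with the Szpiro-slack residue CONE binder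
  exact ABC_of_cor312_of_szpiroSlackRegime (fun P _ l _ _ _ _ _ _ => h312 P l) hresSz

end Family

end Summit.ABC.IUTFork.Conditional

end
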